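import Summits.Schanuel.Schanuel.Theorems.RootDecomp1KHyper78

/-!
# RootDecomp1KHyper — lens 6, generation 18 «BILOG STAIRCASE CELL — THE MEMBER PACKAGE Q1/Q2» (BilogStair.lean EDITION 9 c88597c7…5692, 6929 l; §T appended, §A–§S byte-identical to edition 8 = tree `RootDecomp1KHyper53`–`75`) — continuation (RootDecomp1KHyper79): §T.5 the `HasMeasuredRatAnchor` placement of `z_B` (Q2) + §T.6 `placement_zB''`

(lens-6 g18 `BilogStair.lean` EDITION 9, sha256 c88597c719d23fd42e88a1c5ede12e838e786bf53aa652e8b381b4b663795692, 6929 l, own farm rc 0 · 0 warn · 0 sorry · axioms std; §A–§S = editions 2–8 (ported as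
`RootDecomp1KHyper53`–`75`), ONE import line (`RootDecomp1KHyper51`, the tree's `HasMeasuredRatAnchor`) ADDED and §T appended in edition 9 (NOTE/CLAIM L1849, critic ACK L1855, NODE/EDITION9 L1872 / REQUEST L1873 / RESULT L1874, writer re-check L1877, critic VERDICT L1879 (CLEARED; the reserved K-R20 THIRD⁗ CELL credit AWARDED to lens-6; port GO));
port by census-1 gen 17 as `RootDecomp1KHyper76`–`79`: 76 = §T.1 `PiEllMeasure`, the Baker 1975 Thm 3.1 copy `Baker1975Thm31` (character-identical to
`Literature.NumberTheory.Transcendental.baker1975_thm_3_1`, consumed BY NAME; TODO: replace by the import + `baker1975_thm_3_1_holds` when the Baker chain builds on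
the farm), `piEllMeasure_of_baker` + §T.2 the good level of the tower; 77 = §T.3 the forms of `z_B`, `SmallFormsArePlantedAt`, LEMMA P `smallFormsArePlanted_zB_of`;
78 = §T.4 the tuple-generic PLANTED-STAIRCASE CRITERION `not_hasHLPairInSpan_of_planted` + `not_hasHLPairInSpan_zB_of` / `not_hasHLPairInSpan_zB_of_baker` (Q1);
79 = §T.5 the `HasMeasuredRatAnchor` placement of `z_B` (Q2: `exists_measured_pair_of_hasMeasuredRatAnchor_zB`, `logLattice_mem_of_hasMeasuredRatAnchor_zB`,
`hasMeasuredRatAnchor_zB_of_mvWeakMeasure`/`'`) + §T.6 `placement_zB''`. PORT EDITS: generic one-liners `mul_le_pow_of_two_le` / `sq_le_two_pow_pred` / `two_pow_le_exp_nat` /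
`half_le_ell` / `tau_lt_one` / `mvaeval_mem_adjoin` private (+ per-part private copies of earlier private helpers); statements and proofs verbatim. `--supports stmt-Schanuel-33363`;
no census credit carried; rung 0 — nothing here proves HyperLiouvilleSchanuel in general.)
-/

open Complex Polynomial IntermediateField Filter
open scoped BigOperators

namespace Summit.Schanuel.Schanuel.Theorems.RootDecomp1KHyper

namespace HyperCell

namespace LatCell

namespace Bilog

variable {n : ℕ}
open Summit.Schanuel.Schanuel.Theorems.RootDecomp1KRelLiouvilleCell (mvPolyMeasure_one_of_polyMeasure ycoeff
  mvaeval_cons_eq_sum mvlen_ycoeff_le natDegree_finSuccEquiv_le_totalDegree norm_mvaeval_le_mvlen_mul_pow)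

open Summit.Schanuel.Schanuel.Theorems.RootDecomp1KGeneric (norm_mvAeval_sub_le norm_cexp_sub_cexp_le lenMv
  lenMv_nonneg)

section MemberPkg

open Summit.Schanuel.Schanuel.Theorems.RootDecomp1KGeneric (HasHLPairInSpan)

/-! ### §T.5  The measured-rational-anchor placement of `z_B` -/

/-- Values of integer polynomials at `θ` lie in `ℚ(θ)`. -/
private theorem mvaeval_mem_adjoin {n : ℕ} (θ : Fin n → ℂ) (P : MvPolynomial (Fin n) ℤ) :
    MvPolynomial.aeval θ P ∈ adjoin ℚ (Set.range θ) := by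
  induction P using MvPolynomial.induction_on with
  | C a =>
    rw [MvPolynomial.aeval_C, algebraMap_int_eq, eq_intCast]
    exact intCast_mem _ a
  | add p q hp hq =>
    rw [map_add]; exact add_mem hp hq
  | mul_X p i hp =>
    rw [map_mul, MvPolynomial.aeval_X]
    exact mul_mem hp (subset_adjoin ℚ _ ⟨i, rfl⟩)

/-- **What a measured rational anchor of `z_B` asserts** (unpacking `HasMeasuredRatAnchor z_B`, tree
`RootDecomp1KHyper51`): an EXPLICIT pair `θ ⊂ ℚ(z_B, e^{z_B}, i)` carrying an `MvWeakMeasure` — hence ALGEBRAICALLY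
INDEPENDENT over `ℚ` with an effective measure — whose field `ℚ(θ)` contains two `ℤ`-linearly independent elements
of `span_ℤ(z_B) = i(ℤπ + ℤℓ₀ + ℤy_B)`.  (No such measured pair is recorded in the tree or in `Literature`: every
candidate requires an algebraic-independence MEASURE for two of `π, ℓ₀ = −i log α₀, y_B` (or their exponentials),
an open problem of (π, log α)-type — NODE-g18 §3.) -/
theorem exists_measured_pair_of_hasMeasuredRatAnchor_zB (h : HasMeasuredRatAnchor zB) :
    ∃ (θ : Fin 2 → ℂ) (v₁ v₂ : ℂ), MvWeakMeasure θ ∧ AlgebraicIndependent ℚ θ ∧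
      (∀ i, θ i ∈ adjoin ℚ (SFset zB ∪ {I})) ∧
      v₁ ∈ Submodule.span ℤ (Set.range zB) ∧ v₂ ∈ Submodule.span ℤ (Set.range zB) ∧
      (∀ a b : ℤ, (a : ℂ) * v₁ + (b : ℂ) * v₂ = 0 → a = 0 ∧ b = 0) ∧
      v₁ ∈ adjoin ℚ (Set.range θ) ∧ v₂ ∈ adjoin ℚ (Set.range θ) := by
  obtain ⟨θ, W₁, W₂, q, v₁, v₂, hθ, hθz, hq, hW, hv₁, hv₂, h₁, h₂⟩ := h
  have hθai := algebraicIndependent_of_mvWeakMeasure hθ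
  have hmem : ∀ (W : MvPolynomial (Fin 2) ℤ) (v : ℂ),
      MvPolynomial.aeval θ q * v = MvPolynomial.aeval θ W → v ∈ adjoin ℚ (Set.range θ) := by
    intro W v hv
    rw [(eq_inv_mul_iff_mul_eq₀ hq).mpr hv]
    exact mul_mem (IntermediateField.inv_mem _ (mvaeval_mem_adjoin θ q)) (mvaeval_mem_adjoin θ W)
  refine ⟨θ, v₁, v₂, hθ, hθai, hθz, h₁, h₂, fun a b hab => ?_, hmem W₁ v₁ hv₁, hmem W₂ v₂ hv₂⟩
  by_contra hne
  have hab' : a ≠ 0 ∨ b ≠ 0 := by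
    by_cases ha : a = 0
    · exact Or.inr fun hb => hne ⟨ha, hb⟩
    · exact Or.inl ha
  apply mvaeval_ne_zero_of_mvWeakMeasure hθ (hW a b hab')
  rw [map_add, map_mul, map_mul, MvPolynomial.aeval_C, MvPolynomial.aeval_C, algebraMap_int_eq,
    eq_intCast, eq_intCast, ← hv₁, ← hv₂]
  linear_combination MvPolynomial.aeval θ q * hab

/-- **Every measured rational anchor of `z_B` puts a NON-ZERO point of the LOG LATTICE `i(ℤπ + ℤℓ₀)` into the
measured field `ℚ(θ)`** (the typed consequence asked for in K-R20 Q2): the two independent span elements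
`v_j = i(p_jπ + q_jℓ₀ + s_jy_B)` give `s₂v₁ − s₁v₂ = i((s₂p₁−s₁p₂)π + (s₂q₁−s₁q₂)ℓ₀) ∈ ℚ(θ) ∖ 0` (or `v₁` itself if
`s₁ = s₂ = 0`).  So `HasMeasuredRatAnchor z_B` REQUIRES a pair `θ ⊂ ℚ(i, π, ℓ₀, y_B, e^{iy_B})` with an algebraic-
independence MEASURE whose field meets `ℤ·iπ + ℤ·i log α₀` non-trivially — a measured statement of (π, log α₀)-type;
no such pair is recorded in the tree or in `Literature` (NODE-g18 §3). -/
theorem logLattice_mem_of_hasMeasuredRatAnchor_zB (h : HasMeasuredRatAnchor zB) :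
    ∃ (θ : Fin 2 → ℂ) (U V : ℤ), MvWeakMeasure θ ∧ AlgebraicIndependent ℚ θ ∧
      (∀ i, θ i ∈ adjoin ℚ (SFset zB ∪ {I})) ∧ (U ≠ 0 ∨ V ≠ 0) ∧
      ((((U : ℝ) * Real.pi + (V : ℝ) * ell : ℝ)) : ℂ) * I ∈ adjoin ℚ (Set.range θ) := by
  obtain ⟨θ, v₁, v₂, hθ, hθai, hθz, hv₁, hv₂, hind, hm₁, hm₂⟩ :=
    exists_measured_pair_of_hasMeasuredRatAnchor_zB h
  obtain ⟨p₁, q₁, s₁, e₁⟩ := mem_span_zB hv₁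
  obtain ⟨p₂, q₂, s₂, e₂⟩ := mem_span_zB hv₂
  by_cases hs : s₁ = 0 ∧ s₂ = 0
  · obtain ⟨hs₁, hs₂⟩ := hs
    refine ⟨θ, p₁, q₁, hθ, hθai, hθz, ?_, ?_⟩
    · by_contra hpq
      push Not at hpq
      obtain ⟨hp, hq⟩ := hpq
      have hv0 : v₁ = 0 := by rw [e₁, hp, hq, hs₁]; push_cast; ring
      have := hind 1 0 (by rw [hv0]; push_cast; ring)
      exact one_ne_zero this.1
    · have hw : ((((p₁ : ℝ) * Real.pi + (q₁ : ℝ) * ell : ℝ)) : ℂ) * I = v₁ := by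
        rw [e₁, hs₁]; push_cast; ring
      rw [hw]; exact hm₁
  · refine ⟨θ, s₂ * p₁ - s₁ * p₂, s₂ * q₁ - s₁ * q₂, hθ, hθai, hθz, ?_, ?_⟩
    · by_contra hpq
      push Not at hpq
      obtain ⟨hp, hq⟩ := hpq
      have hpC : (s₂ : ℂ) * p₁ - s₁ * p₂ = 0 := by exact_mod_cast hp
      have hqC : (s₂ : ℂ) * q₁ - s₁ * q₂ = 0 := by exact_mod_cast hq
      have hrel : ((s₂ : ℤ) : ℂ) * v₁ + ((-s₁ : ℤ) : ℂ) * v₂ = 0 := by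
        rw [e₁, e₂]; push_cast
        linear_combination (Real.pi : ℂ) * I * hpC + (ell : ℂ) * I * hqC
      have := hind s₂ (-s₁) hrel
      exact hs ⟨by simpa using this.2, this.1⟩
    · have hw : (((((s₂ * p₁ - s₁ * p₂ : ℤ)) : ℝ) * Real.pi + (((s₂ * q₁ - s₁ * q₂ : ℤ)) : ℝ) * ell : ℝ) : ℂ) * I =
          (s₂ : ℂ) * v₁ - (s₁ : ℂ) * v₂ := by
        rw [e₁, e₂]; push_cast; ring
      rw [hw]
      exact sub_mem (mul_mem (intCast_mem _ _) hm₁) (mul_mem (intCast_mem _ _) hm₂)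

/-- **A weak measure for `(iπ, iℓ₀)` would be a measured rational anchor of `z_B`** (`θ = (iπ, iℓ₀) = (z_B 0, z_B 1)`,
`W₁ = X₀`, `W₂ = X₁`, `q = 1`, `v₁ = z_B 0`, `v₂ = z_B 1`).  Hence `¬ HasMeasuredRatAnchor z_B` would REFUTE
`MvWeakMeasure (iπ, iℓ₀)`, an algebraic-independence measure for `π` and `log α₀` — conjecturally TRUE (a consequence of
the quantitative Schanuel conjecture) and neither proved nor refuted anywhere: the NEGATIVE placement
`¬ HasMeasuredRatAnchor z_B` is therefore not a theorem to expect, and the cell is placed by ABSENCE of any measured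
pair (NODE-g18 §3). -/
theorem hasMeasuredRatAnchor_zB_of_mvWeakMeasure
    (hθ : MvWeakMeasure ![(Real.pi : ℂ) * I, (ell : ℂ) * I]) : HasMeasuredRatAnchor zB := by
  refine ⟨![(Real.pi : ℂ) * I, (ell : ℂ) * I], MvPolynomial.X 0, MvPolynomial.X 1, 1, zB 0, zB 1, hθ, ?_, ?_, ?_,
    ?_, ?_, Submodule.subset_span ⟨0, rfl⟩, Submodule.subset_span ⟨1, rfl⟩⟩
  · intro i
    apply subset_adjoin
    fin_cases i
    · exact Or.inl (Or.inl ⟨0, by simp [zB]⟩)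
    · exact Or.inl (Or.inl ⟨1, by simp [zB]⟩)
  · rw [map_one]; exact one_ne_zero
  · intro U V hUV h0
    have e0 := congrArg (MvPolynomial.eval ![1, 0]) h0
    have e1 := congrArg (MvPolynomial.eval ![0, 1]) h0
    simp at e0 e1
    rcases hUV with hU | hV
    · exact hU e0
    · exact hV e1
  · rw [map_one, one_mul, MvPolynomial.aeval_X]; simp [zB]
  · rw [map_one, one_mul, MvPolynomial.aeval_X]; simp [zB]

/-- The same with `(iπ, iy_B)`: a weak measure for `(iπ, iy_B)` would equally be a measured rational anchor of `z_B`. -/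
theorem hasMeasuredRatAnchor_zB_of_mvWeakMeasure'
    (hθ : MvWeakMeasure ![(Real.pi : ℂ) * I, (yB : ℂ) * I]) : HasMeasuredRatAnchor zB := by
  refine ⟨![(Real.pi : ℂ) * I, (yB : ℂ) * I], MvPolynomial.X 0, MvPolynomial.X 1, 1, zB 0, zB 2, hθ, ?_, ?_, ?_,
    ?_, ?_, Submodule.subset_span ⟨0, rfl⟩, Submodule.subset_span ⟨2, rfl⟩⟩
  · intro i
    apply subset_adjoin
    fin_cases i
    · exact Or.inl (Or.inl ⟨0, by simp [zB]⟩)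
    · exact Or.inl (Or.inl ⟨2, by simp [zB]⟩)
  · rw [map_one]; exact one_ne_zero
  · intro U V hUV h0
    have e0 := congrArg (MvPolynomial.eval ![1, 0]) h0
    have e1 := congrArg (MvPolynomial.eval ![0, 1]) h0
    simp at e0 e1
    rcases hUV with hU | hV
    · exact hU e0
    · exact hV e1
  · rw [map_one, one_mul, MvPolynomial.aeval_X]; simp [zB]
  · rw [map_one, one_mul, MvPolynomial.aeval_X]; simp [zB]

/-! ### §T.6  The placement list of `z_B` (EDITION 9) -/

/-- **PLACEMENT of `z_B` (EDITION 9)**, mod Baker 1975 Thm 3.1 (PROVED in the tree as `baker1975_thm_3_1_holds`):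
`ℚ`-linearly independent · hyper-lin-Liouville · NO hyper-Liouville pair in the span (outside `HasHLPairInSpan` /
`HasHLRatio`, hence outside the RealQuad and every coordinate-ratio cell) · no π-INT anchor · no π-lattice anchor ·
no exp-lattice anchor · no ALG-LAT anchor · and `SB 3 z_B` HOLDS (§S). -/
theorem placement_zB'' (hB : Baker1975Thm31) :
    LinearIndependent ℚ zB ∧ HyperLinLiouville zB ∧ ¬ HasHLPairInSpan zB ∧ ¬ HasPiIntAnchor zB ∧
      ¬ HasPiLatAnchor zB ∧ ¬ HasExpLatAnchor zB ∧ ¬ HasAlgLatAnchor zB ∧ SB 3 zB := by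
  obtain ⟨h1, h2, h3, h4, h5, h6⟩ := placement_zB'
  exact ⟨h1, h2, not_hasHLPairInSpan_zB_of_baker hB, h3, h4, h5, h6, sb_three_zB⟩

end MemberPkg

end Bilog
end LatCell
end HyperCell
end Summit.Schanuel.Schanuel.Theorems.RootDecomp1KHyper
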